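import Mathlib.Analysis.Complex.Basic
import Mathlib.Topology.Algebra.InfiniteSum.Basic
import Literature.Computability.AlgebraicComplexity.Apolarity
import Literature.Computability.AlgebraicComplexity.ApolarityAction
import HarnessLib

/-!
# Top-degree apolarity pairing and coefficient functionals

Topic `Literature/Computability/AlgebraicComplexity` (border apolarity toolkit; written for route
`ValiantsHypothesis/BorderApolarity`, crux `FixedWitnessObstructionQP` stmt-ValiantsHypothesis-5778,
and its support item `WitnessToMembership` stmt-5782).

For forms `D, g` of the same degree `j` the apolarity action is a scalar:
`D ⌟ g = C (Σ_{d ∈ supp D} D_d g_d d!)` (`apolarAction_eq_C`).  Writing the degree-`j` exponents as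
the finite type `↥((Finset.univ : Finset σ).finsuppAntidiag j)`, this is the linear functional
`D ↦ Σ_d D_d w_d` of the weighted coefficient vector `w_d = g_d · d!` of `g`
(`apolarAction_eq_zero_iff_sum`), which is what makes "`J_m ⊆ Ann_m(pp)`" a statement about ONE
hyperplane of the coefficient space.  We also record the elementary linear algebra used by the
witness-to-membership argument: prescribed-coefficient forms (`coeff_sum_monomial`,
`isHomogeneous_sum_monomial`), non-vanishing of the weighted vector of a nonzero form
(`weightedCoeff_ne_zero`), and proportionality of two functionals with nested kernels
(`exists_smul_of_sum_eq_zero_imp`).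

Adapted (definition-free) from the crux disprover's candidate proof
`Summits/ValiantsHypothesis/ValiantsHypothesis/Cruxes/FixedWitnessObstructionQP/WitnessToMembershipProof.lean`
(refuter cdisprove gen 2).  Iarrobino–Kanev LNM 1721 §1.1 (the pairing); Buczyńska–Buczyński 2021
§3 (apolarity in coordinates).
-/

namespace Literature.Computability.AlgebraicComplexity.BorderApolarity

open MvPolynomial
open scoped BigOperators

noncomputable section

variable {σ : Type*}

/-- `d! = ∏_{i ∈ supp d} (d i)! ≠ 0` in `ℂ`. [folklore] -/
theorem prod_factorial_ne_zero (d : σ →₀ ℕ) : (∏ i ∈ d.support, ((d i).factorial : ℂ)) ≠ 0 := by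
  rw [Finset.prod_ne_zero_iff]
  intro i _
  exact_mod_cast (d i).factorial_ne_zero

/-- Two exponents of the same degree with `e ≤ d` are equal. [folklore] -/
theorem eq_of_le_of_degree_eq {e d : σ →₀ ℕ} (h : e ≤ d) (hdeg : e.degree = d.degree) : e = d := by
  have h1 : e + (d - e) = d := add_tsub_cancel_of_le h
  have h2 : (d - e).degree = 0 := by
    have := congrArg Finsupp.degree h1
    rw [map_add] at this
    omega
  rw [Finsupp.degree_eq_zero_iff] at h2
  rw [h2, add_zero] at h1
  exact h1

/-- **Top-degree pairing.** For `D, g` homogeneous of the same degree `j`,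
`D ⌟ g = C (Σ_{d ∈ supp D} D_d g_d d!)`. [folklore] -/
theorem apolarAction_eq_C {D g : MvPolynomial σ ℂ} {j : ℕ}
    (hD : D.IsHomogeneous j) (hg : g.IsHomogeneous j) :
    apolarAction D g =
      C (∑ d ∈ D.support, coeff d D * coeff d g * ∏ i ∈ d.support, ((d i).factorial : ℂ)) := by
  classical
  rw [apolarAction_def, map_sum]
  refine Finset.sum_congr rfl fun e he => ?_
  have hedeg : e.degree = j := by
    rw [Finsupp.degree_eq_weight_one]; exact hD (mem_support_iff.1 he)
  -- the inner sum collapses to the `d = e` term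
  rw [Finset.sum_eq_single e]
  · have hprod : (∏ i ∈ e.support, (Nat.descFactorial (e i) (e i) : ℂ)) =
        ∏ i ∈ e.support, ((e i).factorial : ℂ) := by
      refine Finset.prod_congr rfl fun i _ => ?_
      rw [Nat.descFactorial_self]
    rw [tsub_self, hprod]
    rfl
  · intro d hd hne
    have hddeg : d.degree = j := by
      rw [Finsupp.degree_eq_weight_one]; exact hg (mem_support_iff.1 hd)
    have hnle : ¬ e ≤ d := fun hle => hne (eq_of_le_of_degree_eq hle (hedeg.trans hddeg.symm)).symm
    obtain ⟨i, hi⟩ : ∃ i, d i < e i := by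
      by_contra hcon
      push Not at hcon
      exact hnle fun i => hcon i
    have hie : i ∈ e.support := by
      rw [Finsupp.mem_support_iff]; omega
    have hzero : (Nat.descFactorial (d i) (e i) : ℂ) = 0 := by
      rw [Nat.descFactorial_eq_zero_iff_lt.2 hi, Nat.cast_zero]
    rw [Finset.prod_eq_zero hie hzero, mul_zero, map_zero]
  · intro hne
    rw [notMem_support_iff] at hne
    rw [hne, mul_zero, zero_mul, map_zero]

section Fin

variable [Fintype σ]

/-- Membership in the degree-`j` antidiagonal of all variables is `degree = j`. [folklore] -/
theorem mem_finsuppAntidiag_univ_iff [DecidableEq σ] {j : ℕ} {d : σ →₀ ℕ} :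
    d ∈ (Finset.univ : Finset σ).finsuppAntidiag j ↔ d.degree = j := by
  simp [Finset.mem_finsuppAntidiag, Finsupp.degree_eq_sum]

/-- A sum over the support of a degree-`j` form is a sum over all degree-`j` exponents (as the
finite type `↥(univ.finsuppAntidiag j)`), for summands vanishing off the support. [folklore] -/
theorem sum_support_eq_sum_antidiag [DecidableEq σ] {j : ℕ} {D : MvPolynomial σ ℂ}
    (hD : D.IsHomogeneous j) (F : (σ →₀ ℕ) → ℂ) (hF : ∀ d, coeff d D = 0 → F d = 0) :
    ∑ d ∈ D.support, F d = ∑ d : ((Finset.univ : Finset σ).finsuppAntidiag j), F d.1 := by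
  have hsub : D.support ⊆ (Finset.univ : Finset σ).finsuppAntidiag j := by
    intro d hd
    have : d.degree = j := by
      rw [Finsupp.degree_eq_weight_one]; exact hD (mem_support_iff.1 hd)
    exact mem_finsuppAntidiag_univ_iff.2 this
  rw [Finset.sum_subset hsub (fun d _ hd => hF d (notMem_support_iff.1 hd))]
  rw [← Finset.sum_coe_sort]

/-- **Pairing in functional form**: for forms `D, g` of degree `j`,
`D ⌟ g = C (Σ_{|d| = j} D_d · (g_d d!))`. [folklore] -/
theorem apolarAction_eq_C_sum [DecidableEq σ] {D g : MvPolynomial σ ℂ} {j : ℕ}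
    (hD : D.IsHomogeneous j) (hg : g.IsHomogeneous j) :
    apolarAction D g = C (∑ d : ((Finset.univ : Finset σ).finsuppAntidiag j),
      coeff d.1 D * (coeff d.1 g * ∏ i ∈ d.1.support, ((d.1 i).factorial : ℂ))) := by
  rw [apolarAction_eq_C hD hg]
  congr 1
  rw [sum_support_eq_sum_antidiag hD
    (fun d => coeff d D * coeff d g * ∏ i ∈ d.support, ((d i).factorial : ℂ))
    (fun d hd => by rw [hd, zero_mul, zero_mul])]
  refine Finset.sum_congr rfl fun d _ => ?_
  ring

/-- Hence, for forms of degree `j`: `D ⌟ g = 0 ↔ Σ_{|d| = j} D_d (g_d d!) = 0`. [folklore] -/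
theorem apolarAction_eq_zero_iff_sum [DecidableEq σ] {D g : MvPolynomial σ ℂ} {j : ℕ}
    (hD : D.IsHomogeneous j) (hg : g.IsHomogeneous j) :
    apolarAction D g = 0 ↔ (∑ d : ((Finset.univ : Finset σ).finsuppAntidiag j),
      coeff d.1 D * (coeff d.1 g * ∏ i ∈ d.1.support, ((d.1 i).factorial : ℂ))) = 0 := by
  rw [apolarAction_eq_C_sum hD hg]
  exact C_eq_zero

/-- The coefficient functional `w ↦ Σ_d D_d w_d` is continuous in the weight `w`. [folklore] -/
theorem continuous_sum_coeff_mul {ι : Type*} [Fintype ι] (a : ι → ℂ) :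
    Continuous fun w : ι → ℂ => ∑ d, a d * w d :=
  continuous_finsetSum _ fun d _ => continuous_const.mul (continuous_apply d)

/-- Coefficients of the form with prescribed degree-`j` coefficient vector `c`. [folklore] -/
theorem coeff_sum_monomial [DecidableEq σ] {j : ℕ}
    (c : ((Finset.univ : Finset σ).finsuppAntidiag j) → ℂ)
    (d : ((Finset.univ : Finset σ).finsuppAntidiag j)) :
    coeff d.1 (∑ e : ((Finset.univ : Finset σ).finsuppAntidiag j), monomial e.1 (c e)) = c d := by
  rw [coeff_sum, Finset.sum_eq_single d]
  · rw [coeff_monomial, if_pos rfl]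
  · intro e _ hne
    rw [coeff_monomial, if_neg]
    exact fun h => hne (Subtype.ext h)
  · intro h; exact absurd (Finset.mem_univ d) h

/-- Coefficients off degree `j` of the prescribed-coefficient form vanish. [folklore] -/
theorem coeff_sum_monomial_of_ne [DecidableEq σ] {j : ℕ}
    (c : ((Finset.univ : Finset σ).finsuppAntidiag j) → ℂ) {d : σ →₀ ℕ} (hd : d.degree ≠ j) :
    coeff d (∑ e : ((Finset.univ : Finset σ).finsuppAntidiag j), monomial e.1 (c e)) = 0 := by
  rw [coeff_sum]
  refine Finset.sum_eq_zero fun e _ => ?_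
  rw [coeff_monomial, if_neg]
  intro h
  exact hd (h ▸ mem_finsuppAntidiag_univ_iff.1 e.2)

/-- The prescribed-coefficient form is homogeneous of degree `j`. [folklore] -/
theorem isHomogeneous_sum_monomial [DecidableEq σ] {j : ℕ}
    (c : ((Finset.univ : Finset σ).finsuppAntidiag j) → ℂ) :
    (∑ e : ((Finset.univ : Finset σ).finsuppAntidiag j), monomial e.1 (c e)).IsHomogeneous j := by
  refine IsHomogeneous.sum _ _ _ fun e _ => ?_
  exact isHomogeneous_monomial _ (mem_finsuppAntidiag_univ_iff.1 e.2)

/-- A nonzero form of degree `j` has a nonzero weighted coefficient vector `d ↦ g_d · d!`.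
[folklore] -/
theorem weightedCoeff_ne_zero [DecidableEq σ] {j : ℕ} {g : MvPolynomial σ ℂ}
    (hg : g.IsHomogeneous j) (hne : g ≠ 0) :
    (fun d : ((Finset.univ : Finset σ).finsuppAntidiag j) =>
      coeff d.1 g * ∏ i ∈ d.1.support, ((d.1 i).factorial : ℂ)) ≠ 0 := by
  obtain ⟨d, hd⟩ := ne_zero_iff.1 hne
  have hdeg : d.degree = j := by
    rw [Finsupp.degree_eq_weight_one]; exact hg hd
  intro h
  have := congrFun h ⟨d, mem_finsuppAntidiag_univ_iff.2 hdeg⟩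
  simp only [Pi.zero_apply, mul_eq_zero] at this
  rcases this with h1 | h2
  · exact hd h1
  · exact prod_factorial_ne_zero d h2

end Fin

/-- **Proportionality**: on a finite coordinate space, if `Σ c_d v_d = 0 ⟹ Σ c_d u_d = 0` for
every test vector `c` and `v ≠ 0`, then `u = μ • v`. [folklore] -/
theorem exists_smul_of_sum_eq_zero_imp {ι : Type*} [Fintype ι] [DecidableEq ι] (v u : ι → ℂ)
    (hv : v ≠ 0) (h : ∀ c : ι → ℂ, (∑ d, c d * v d) = 0 → (∑ d, c d * u d) = 0) :
    ∃ μ : ℂ, u = μ • v := by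
  obtain ⟨d₀, hd₀⟩ : ∃ d₀, v d₀ ≠ 0 := by
    by_contra hcon; push Not at hcon; exact hv (funext hcon)
  refine ⟨u d₀ / v d₀, funext fun d => ?_⟩
  -- test vector `c = v d₀ • e_d − v d • e_{d₀}`
  have key := h (fun e => (if e = d then v d₀ else 0) - (if e = d₀ then v d else 0)) ?_
  · simp only [sub_mul, Finset.sum_sub_distrib, ite_mul, zero_mul, Finset.sum_ite_eq',
      Finset.mem_univ, if_true] at key
    simp only [Pi.smul_apply, smul_eq_mul]
    field_simp
    linear_combination key
  · simp only [sub_mul, Finset.sum_sub_distrib, ite_mul, zero_mul, Finset.sum_ite_eq',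
      Finset.mem_univ, if_true]
    ring

/-- `Σ_d conj(u_d) u_d ≠ 0` for `u ≠ 0`. [folklore] -/
theorem sum_conj_mul_self_ne_zero {ι : Type*} [Fintype ι] {u : ι → ℂ} (hu : u ≠ 0) :
    (∑ d, (starRingEnd ℂ) (u d) * u d) ≠ 0 := by
  have h : (∑ d, (starRingEnd ℂ) (u d) * u d) = ((∑ d, ‖u d‖ ^ 2 : ℝ) : ℂ) := by
    push_cast
    refine Finset.sum_congr rfl fun d _ => ?_
    rw [Complex.conj_mul']
  rw [h]
  intro h0
  have h0' : (∑ d, ‖u d‖ ^ 2 : ℝ) = 0 := by exact_mod_cast h0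
  apply hu
  funext d
  have := (Finset.sum_eq_zero_iff_of_nonneg (fun d _ => sq_nonneg ‖u d‖)).1 h0' d (Finset.mem_univ d)
  exact norm_eq_zero.1 ((pow_eq_zero_iff two_ne_zero).1 this)

end

end Literature.Computability.AlgebraicComplexity.BorderApolarity
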